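import Summits.QuantumFields.BalabanUV.Beta.GAN24.PiBmConstants
import Summits.QuantumFields.BalabanUV.Beta.GAN24.BiStencilZeroMode

/-!
# `BalabanUV.Beta.GAN24.CoProjSlotCharges` — binder row G-an2-4 ∕ (CONV-C), W-slot CT-route «CT-W» (the row owner gan24-p1 g23's W3 re-cut of (R-CT),
# journal l.37785, item (W3)(b); leaf-02 g52's located finding F-leaf02-g52-1, l.37867): **THE TOTAL OF A `Πᵀ_bm`-DRESSED SLOT IS `N` TIMES ITS
# FACE SUM** — `Σ'_q (Πᵀ_bm g)_α(q) = N·Σ'_{q : q_α % N = N−1} g_α(q)` (full lattice), the same on ONE CELL for an `N`-periodic one-form, the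
# sawtooth ∕ divergence form of the defect `Σ' (Πᵀ_bm g − g)_α = Σ'_p (p_α % N)·(div g)(p)`, and the instances on an2's `MKer`-valued bond slot
# `coProjBmAtK` and on the two kernel-leg dressings `legCo₁BmAt` ∕ `legCo₂BmAt` ∕ `dressKBmAt`

NOT IN PRINT; OUR BOOKKEEPING (G-an2-4 crux team (2), leaf prover `b2b-balaban-gan24-formalise-leaf-02`, gen 52; journal [LEAF02-G52-ONLINE] ∕ INTENT
[LEAF02-G52-INTENT1] l.37867; PART 1 of the kernel certificate of the finding «`𝔇` does not preserve the cell charge, it reads the FOUR-FACE charge»;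
PART 2 = `GAN24/TableDressingZeroMode`).  PRIOR ART BY NAME, nothing re-derived: the ROW sums of the matrix of `Π_bm` and the face read-out are
gan24-p4's `GAN24/PiBmConstants` §3 (`sum_cube_sum_pmBm_col_mul`, `tsum_pmBm_row`, `summable_pmBm_row`) and its §4 is the PAIR-`tsum` form of the
double kernel-leg instance below (`tsum_prod_dressKBmAt_inl_inl` — «the dressing does NOT preserve the double-leg total»); the cell ∕ periodic
bookkeeping is leaf-02 g15's `BiStencilZeroMode.tsum_eq_sum_box_tsum` ∕ `tsum_mul_periodic`; the window objects are an2's `AxialDressingRooted.pmBm` ∕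
`cube` ∕ `coProjBmAt` ∕ `coProjBmAtK` ∕ `legCo₁BmAt` ∕ `legCo₂BmAt` ∕ `dressKBmAt` ∕ `pmBm_shift` ∕ `window_of_pmBm_ne_zero` ∕ `abs_pmBm_le`.
HONEST FRAMING (cell contract, verbatim): «discharging `BetaPertH` makes Bałaban's UV stability UNCONDITIONAL — a real constructive-QFT result; it is
NOT the continuum limit and NOT the Clay problem.»  HONEST DEPENDENCY (verbatim): «continuum YM on T⁴ ⇐ BetaPertH ∧ nine spine estimates (0/9 proved);
BetaPertH ⇐ (D1) ∧ (D4) ∧ CAP+tail; G-an2-4 gates asym, D1 and NE2/3/4.»  [folklore] lattice-sum bookkeeping; generic dimension `d+1`, `1 ≤ N`,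
in-block root `ρ = toSite r`; 0 `def`, 0 cited facts, 0 `def … : Prop`, 0 sorry.  NO estimate of Bałaban's; discharges NOTHING of (hW, hWall) ∕
«T2Shape» ∕ «T2Drift»; 0 wall binders; NEVER «G-an2-4 closed» as (CONV-C); NOT D1, NOT BetaPertH, NOT continuum, NOT Clay.

## What (`ρ = toSite r`, `r ∈ box (d+1) N`, `1 ≤ N`)
* §1 FULL-LATTICE SLOT, FACE FORM: `summable_coProjBmAt`; **`tsum_coProjBmAt_eq_face`**: for a one-form with summable components,
  `Σ'_q coProjBmAt ρ N g α q = N · Σ'_q (if q_α % N = N−1 then g α q else 0)` — `⟨1_α, Πᵀ_bm g⟩ = ⟨Π_bm 1_α, g⟩` and `Π_bm 1_α = N·𝟙[α-bonds crossing an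
  α-face]` (`PiBmConstants.axProjBmAt_const`): `Πᵀ_bm` does NOT preserve slot totals (contrast `SrecChargeBm.tsum_coProjBmW`: `Π_bm` does).
* §2 SAWTOOTH ∕ DIVERGENCE FORM: **`tsum_coProjBmAt_sub_self_eq_saw_div`**: `Σ'_q (coProjBmAt ρ N g α q − g α q) = Σ'_p (p_α % N)·Σ_β (g β p − g β (p − e_β))`
  — the defect of a slot TOTAL is the pairing of the slot's DIVERGENCE with the in-block SAWTOOTH `p ↦ p_α % N` (the in-block gauge of the constant form
  `1_α` up to a block constant; leaf-02 g51's pointwise `CoProjBmDivFree.coProjBmAt_eq_self_sub_tsum_div` summed); `tsum_coProjBmAt_eq_self_of_divFree`.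
* §3 ONE CELL, PERIODIC ONE-FORM: **`sum_box_coProjBmAt_eq_face_of_periodic`**: for `F β (q + N•t) = F β q`,
  `Σ_{r′ ∈ box} coProjBmAt ρ N F α (toSite r′) = N · Σ_{r′ ∈ box} (if (toSite r′)_α % N = N−1 then F α (toSite r′) else 0)` (window → lattice sum, periodic
  regrouping `tsum_mul_periodic`, coarse covariance `pmBm_shift`, cell unfolding `tsum_eq_sum_box_tsum`, `tsum_pmBm_row`).
* §4 INSTANCES: `tsum_coProjBmAtK_eq_face` (an2's bond slot), `tsum_legCo₁BmAt_inl_eq_face` ∕ `tsum_legCo₂BmAt_inl_eq_face` (one kernel leg),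
  **`tsum_tsum_dressKBmAt_inl_inl_eq_face`** (both kernel legs, ITERATED sums: `Σ'_x Σ'_z dressKBmAt ρ N X x z (inl α) (inl β) = N²·Σ'_x Σ'_z [x_α, z_β at
  faces]·X x z (inl α) (inl β)` — gan24-p4's pair form re-read for `BiStencilZeroMode.zmode`'s iterated sums).
-/

noncomputable section

open Finset
open scoped BigOperators
open Literature.MathematicalPhysics.QuantumFieldTheory
open Literature.MathematicalPhysics.QuantumFieldTheory.Balaban1983to89
open Literature.MathematicalPhysics.QuantumFieldTheory.Balaban1983to89.Beta
open ExpKernelCalculus (MKer)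
open AffineAveraging (Form1 Site box toSite unitVec unitVec_apply)
open OneStepResolventKernel (Fib)
open Summit.QuantumFields.BalabanUV.Beta.AxialDressingRooted (pmBm cube mem_cube window_of_pmBm_ne_zero abs_pmBm_le pmBm_shift coProjBmAt
  coProjBmAt_apply coProjBmAtK coProjBmAtK_eval dressKBmAt dressKBmAt_eq_legs legCo₁BmAt legCo₂BmAt legCo₁BmAt_inl legCo₂BmAt_inl)
open Summit.QuantumFields.BalabanUV.Beta.GAN24.PiBmConstants (sum_cube_sum_pmBm_col_mul tsum_pmBm_row summable_pmBm_row)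
open Summit.QuantumFields.BalabanUV.Beta.GAN24.BiStencilZeroMode (tsum_eq_sum_box_tsum tsum_mul_periodic)

namespace Summit.QuantumFields.BalabanUV.Beta.GAN24.CoProjSlotCharges

variable {d : ℕ} {N : ℕ} {r : Fin (d + 1) → ℕ}

/-! ## §1 The total of a `Πᵀ_bm`-dressed slot over the full lattice: face form -/

/-- [folklore] One window term of `Πᵀ_bm g` is summable in the slot variable (bounded matrix entry × shifted summable component). -/
theorem summable_window_term (hN : 1 ≤ N) (hr : r ∈ box (d + 1) N) {g : Form1 (d + 1) ℝ} (hg : ∀ β, Summable (g β))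
    (α β : Fin (d + 1)) (v : Site (d + 1)) :
    Summable fun q : Site (d + 1) => pmBm (toSite r) N β (q + v) α q * g β (q + v) := by
  have hs : Summable fun q : Site (d + 1) => g β (q + v) := (Equiv.addRight v).summable_iff.2 (hg β)
  refine Summable.of_norm_bounded (hs.abs.mul_left (1 + 4 * (((d : ℝ) + 1) * N))) fun q => ?_
  rw [Real.norm_eq_abs, abs_mul]
  exact mul_le_mul_of_nonneg_right (abs_pmBm_le hN hr β (q + v) α q) (abs_nonneg _)

/-- [folklore] **A `Πᵀ_bm`-DRESSED SLOT WITH SUMMABLE COMPONENTS IS SUMMABLE** (finite window sum of summable terms). -/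
theorem summable_coProjBmAt (hN : 1 ≤ N) (hr : r ∈ box (d + 1) N) {g : Form1 (d + 1) ℝ} (hg : ∀ β, Summable (g β)) (α : Fin (d + 1)) :
    Summable fun q : Site (d + 1) => coProjBmAt (toSite r) N g α q := by
  have e : (fun q : Site (d + 1) => coProjBmAt (toSite r) N g α q)
      = fun q => ∑ v ∈ cube (d + 1) N, ∑ β : Fin (d + 1), pmBm (toSite r) N β (q + v) α q * g β (q + v) :=
    funext fun q => coProjBmAt_apply _ _ _ _ _
  rw [e]
  exact summable_sum fun v _ => summable_sum fun β _ => summable_window_term hN hr hg α β v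

/-- NOT IN PRINT; OUR BOOKKEEPING.  **THE TOTAL OF A `Πᵀ_bm`-DRESSED SLOT IS `N` TIMES ITS FACE SUM** (in-block root `ρ = toSite r`, `1 ≤ N`, one-form with
summable components): `Σ'_q coProjBmAt ρ N g α q = N · Σ'_q (if q_α % N = N − 1 then g α q else 0)`.  As bilinear pairings `⟨1_α, Πᵀ_bm g⟩ = ⟨Π_bm 1_α, g⟩`,
and `Π_bm 1_α` is `N` times the indicator of the `α`-bonds crossing an `α`-face (the ROW sums of the matrix of `Π_bm`, gan24-p4's
`PiBmConstants.sum_cube_sum_pmBm_col_mul`).  Proof: window form, finite sums out of the series, one lattice shift `q ↦ q − v` per window offset, finite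
sums back in, row read-out. -/
theorem tsum_coProjBmAt_eq_face (hN : 1 ≤ N) (hr : r ∈ box (d + 1) N) {g : Form1 (d + 1) ℝ} (hg : ∀ β, Summable (g β)) (α : Fin (d + 1)) :
    ∑' q : Site (d + 1), coProjBmAt (toSite r) N g α q
      = (N : ℝ) * ∑' q : Site (d + 1), (if q α % (N : ℤ) = (N : ℤ) - 1 then g α q else 0) := by
  -- the shifted window terms
  have hT' : ∀ (v : Site (d + 1)) (β : Fin (d + 1)), Summable fun p : Site (d + 1) => pmBm (toSite r) N β p α (p - v) * g β p := by
    intro v β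
    refine Summable.of_norm_bounded ((hg β).abs.mul_left (1 + 4 * (((d : ℝ) + 1) * N))) fun p => ?_
    rw [Real.norm_eq_abs, abs_mul]
    exact mul_le_mul_of_nonneg_right (abs_pmBm_le hN hr β p α (p - v)) (abs_nonneg _)
  have hshift : ∀ (v : Site (d + 1)) (β : Fin (d + 1)),
      ∑' q : Site (d + 1), pmBm (toSite r) N β (q + v) α q * g β (q + v) = ∑' p : Site (d + 1), pmBm (toSite r) N β p α (p - v) * g β p := by
    intro v β
    rw [← (Equiv.addRight v).tsum_eq (fun p : Site (d + 1) => pmBm (toSite r) N β p α (p - v) * g β p)]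
    refine tsum_congr fun q => ?_
    simp only [Equiv.coe_addRight, add_sub_cancel_right]
  have e1 : ∑' q : Site (d + 1), coProjBmAt (toSite r) N g α q
      = ∑' q : Site (d + 1), ∑ v ∈ cube (d + 1) N, ∑ β : Fin (d + 1), pmBm (toSite r) N β (q + v) α q * g β (q + v) :=
    tsum_congr fun q => coProjBmAt_apply _ _ _ _ _
  rw [e1, Summable.tsum_finsetSum fun v _ => summable_sum fun β _ => summable_window_term hN hr hg α β v]
  have e2 : ∀ v ∈ cube (d + 1) N, ∑' q : Site (d + 1), ∑ β : Fin (d + 1), pmBm (toSite r) N β (q + v) α q * g β (q + v)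
      = ∑ β : Fin (d + 1), ∑' p : Site (d + 1), pmBm (toSite r) N β p α (p - v) * g β p := by
    intro v _
    rw [Summable.tsum_finsetSum fun β _ => summable_window_term hN hr hg α β v]
    exact Finset.sum_congr rfl fun β _ => hshift v β
  rw [Finset.sum_congr rfl e2]
  -- finite sums back inside
  have e3 : ∑ v ∈ cube (d + 1) N, ∑ β : Fin (d + 1), ∑' p : Site (d + 1), pmBm (toSite r) N β p α (p - v) * g β p
      = ∑' p : Site (d + 1), ∑ v ∈ cube (d + 1) N, ∑ β : Fin (d + 1), pmBm (toSite r) N β p α (p - v) * g β p := by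
    rw [Summable.tsum_finsetSum fun v _ => summable_sum fun β _ => hT' v β]
    exact Finset.sum_congr rfl fun v _ => (Summable.tsum_finsetSum fun β _ => hT' v β).symm
  rw [e3, ← tsum_mul_left]
  refine tsum_congr fun p => ?_
  rw [sum_cube_sum_pmBm_col_mul hN hr (fun β => g β p) p α]
  split_ifs <;> simp

/-- [folklore] The face-restricted component is summable. -/
theorem summable_face (N : ℕ) {g : Form1 (d + 1) ℝ} (hg : ∀ β, Summable (g β)) (α : Fin (d + 1)) :
    Summable fun q : Site (d + 1) => (if q α % (N : ℤ) = (N : ℤ) - 1 then g α q else 0) := by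
  refine Summable.of_norm_bounded (hg α).abs fun q => ?_
  rw [Real.norm_eq_abs]
  split_ifs
  · exact le_rfl
  · rw [abs_zero]; exact abs_nonneg _

/-! ## §2 The defect of the slot total in sawtooth ∕ divergence form -/

/-- [folklore] **THE IN-BLOCK SAWTOOTH ACROSS ONE BOND**: `(a + 1) % n = a % n + 1 − n·[a % n = n − 1]` (`0 < n`). -/
theorem int_succ_emod {n : ℤ} (hn : 0 < n) (a : ℤ) :
    (a + 1) % n = a % n + 1 - (if a % n = n - 1 then n else 0) := by
  have e : n * (a / n) + a % n = a := Int.mul_ediv_add_emod a n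
  have e' : n * ((a + 1) / n) + (a + 1) % n = a + 1 := Int.mul_ediv_add_emod (a + 1) n
  have hd := PiBmConstants.int_succ_ediv hn a
  by_cases h : a % n = n - 1
  · rw [if_pos h]
    rw [if_pos h] at hd
    rw [hd, mul_add, mul_one] at e'
    linarith
  · rw [if_neg h]
    rw [if_neg h, add_zero] at hd
    rw [hd] at e'
    linarith

/-- [folklore] The sawtooth is bounded: `|p_α % N| ≤ N` (`1 ≤ N`). -/
theorem abs_emod_le (hN : 1 ≤ N) (a : ℤ) : |((a % (N : ℤ) : ℤ) : ℝ)| ≤ (N : ℝ) := by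
  have hN' : (0 : ℤ) < N := by exact_mod_cast hN
  have h0 : 0 ≤ a % (N : ℤ) := Int.emod_nonneg a hN'.ne'
  have h1 : a % (N : ℤ) < N := Int.emod_lt_of_pos a hN'
  rw [abs_of_nonneg (by exact_mod_cast h0)]
  exact_mod_cast h1.le

/-- NOT IN PRINT; OUR BOOKKEEPING.  **THE DEFECT OF A SLOT TOTAL IS THE PAIRING OF THE SLOT'S DIVERGENCE WITH THE IN-BLOCK SAWTOOTH** (in-block root,
`1 ≤ N`, summable components): `Σ'_q (coProjBmAt ρ N g α q − g α q) = Σ'_p (p_α % N)·Σ_β (g β p − g β (p − e_β))`.  The sawtooth `p ↦ p_α % N` is the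
in-block gauge of the constant form `1_α` up to a block constant (which pairs to zero with a divergence); its gradient is `1_α − N·𝟙[α-face bonds]`, so
summation by parts turns §1's `N·(face sum) − (total)` into this pairing.  COROLLARY: a slot whose (summable) one-form is DIVERGENCE-FREE keeps its total
under `Πᵀ_bm` (`tsum_coProjBmAt_eq_self_of_divFree`) — the totals-level face of leaf-02 g51's pointwise `CoProjBmDivFree.coProjBmAt_eq_self_of_divFree`. -/
theorem tsum_coProjBmAt_sub_self_eq_saw_div (hN : 1 ≤ N) (hr : r ∈ box (d + 1) N) {g : Form1 (d + 1) ℝ} (hg : ∀ β, Summable (g β)) (α : Fin (d + 1)) :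
    ∑' q : Site (d + 1), (coProjBmAt (toSite r) N g α q - g α q)
      = ∑' p : Site (d + 1), ((p α % (N : ℤ) : ℤ) : ℝ) * ∑ β : Fin (d + 1), (g β p - g β (p - unitVec β)) := by
  have hN' : (0 : ℤ) < N := by exact_mod_cast hN
  set s : Site (d + 1) → ℝ := fun p => ((p α % (N : ℤ) : ℤ) : ℝ) with hs
  have hsb : ∀ p, |s p| ≤ (N : ℝ) := fun p => abs_emod_le hN (p α)
  -- summability of the pieces
  have hsg : ∀ β, Summable fun p : Site (d + 1) => s p * g β p := fun β =>
    Summable.of_norm_bounded ((hg β).abs.mul_left (N : ℝ)) fun p => by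
      rw [Real.norm_eq_abs, abs_mul]; exact mul_le_mul_of_nonneg_right (hsb p) (abs_nonneg _)
  have hsg' : ∀ β, Summable fun p : Site (d + 1) => s p * g β (p - unitVec β) := fun β =>
    Summable.of_norm_bounded (((Equiv.subRight (unitVec β)).summable_iff.2 (hg β)).abs.mul_left (N : ℝ)) fun p => by
      rw [Real.norm_eq_abs, abs_mul]; exact mul_le_mul_of_nonneg_right (hsb p) (abs_nonneg _)
  have hsg'' : ∀ β, Summable fun p : Site (d + 1) => s (p + unitVec β) * g β p := fun β =>
    Summable.of_norm_bounded ((hg β).abs.mul_left (N : ℝ)) fun p => by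
      rw [Real.norm_eq_abs, abs_mul]; exact mul_le_mul_of_nonneg_right (hsb _) (abs_nonneg _)
  -- right side: split the finite `β`-sum, shift the second piece
  have eR : ∑' p : Site (d + 1), s p * ∑ β : Fin (d + 1), (g β p - g β (p - unitVec β))
      = ∑ β : Fin (d + 1), ∑' p : Site (d + 1), (s p - s (p + unitVec β)) * g β p := by
    have e1 : (fun p : Site (d + 1) => s p * ∑ β : Fin (d + 1), (g β p - g β (p - unitVec β)))
        = fun p => ∑ β : Fin (d + 1), (s p * g β p - s p * g β (p - unitVec β)) := by
      funext p; rw [Finset.mul_sum]; exact Finset.sum_congr rfl fun β _ => by ring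
    rw [e1, Summable.tsum_finsetSum fun β _ => (hsg β).sub (hsg' β)]
    refine Finset.sum_congr rfl fun β _ => ?_
    rw [(hsg β).tsum_sub (hsg' β)]
    have esh : ∑' p : Site (d + 1), s p * g β (p - unitVec β) = ∑' p : Site (d + 1), s (p + unitVec β) * g β p := by
      rw [← (Equiv.addRight (unitVec β)).tsum_eq (fun p : Site (d + 1) => s p * g β (p - unitVec β))]
      refine tsum_congr fun p => ?_
      simp only [Equiv.coe_addRight, add_sub_cancel_right]
    rw [esh, ← (hsg β).tsum_sub (hsg'' β)]
    exact tsum_congr fun p => by ring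
  -- the sawtooth step: `s p − s (p + e_β) = [β = α]·(N·[face] − 1)`
  have estep : ∀ (β : Fin (d + 1)) (p : Site (d + 1)), (s p - s (p + unitVec β)) * g β p
      = if β = α then ((if p α % (N : ℤ) = (N : ℤ) - 1 then (N : ℝ) * g α p else 0) - g α p) else 0 := by
    intro β p
    by_cases hβ : β = α
    · subst hβ
      rw [if_pos rfl]
      have h1 : (p + unitVec β) β = p β + 1 := by rw [Pi.add_apply, unitVec_apply, if_pos rfl]
      simp only [hs, h1, int_succ_emod hN' (p β)]
      split_ifs with hf
      · push_cast; ring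
      · push_cast; ring
    · rw [if_neg hβ]
      have h1 : (p + unitVec β) α = p α := by
        rw [Pi.add_apply, unitVec_apply, if_neg (fun h => hβ h.symm), add_zero]
      simp only [hs, h1, sub_self, zero_mul]
  rw [eR]
  simp_rw [estep]
  rw [Finset.sum_eq_single α (fun β _ hβ => by simp only [if_neg hβ, tsum_zero]) (fun h => absurd (Finset.mem_univ α) h)]
  simp only [if_true]
  -- left side: §1
  rw [(summable_coProjBmAt hN hr hg α).tsum_sub (hg α), tsum_coProjBmAt_eq_face hN hr hg α, ← tsum_mul_left,
    ← ((summable_face N hg α).mul_left (N : ℝ)).tsum_sub (hg α)]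
  exact tsum_congr fun p => by split_ifs <;> simp

/-- NOT IN PRINT; OUR BOOKKEEPING.  COROLLARY: **A DIVERGENCE-FREE SLOT KEEPS ITS TOTAL UNDER `Πᵀ_bm`** (summable components; `Σ_β (g β p − g β (p − e_β)) = 0`
at every site). -/
theorem tsum_coProjBmAt_eq_self_of_divFree (hN : 1 ≤ N) (hr : r ∈ box (d + 1) N) {g : Form1 (d + 1) ℝ} (hg : ∀ β, Summable (g β)) (α : Fin (d + 1))
    (hdiv : ∀ p : Site (d + 1), ∑ β : Fin (d + 1), (g β p - g β (p - unitVec β)) = 0) :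
    ∑' q : Site (d + 1), coProjBmAt (toSite r) N g α q = ∑' q : Site (d + 1), g α q := by
  have h := tsum_coProjBmAt_sub_self_eq_saw_div hN hr hg α
  simp only [hdiv, mul_zero, tsum_zero] at h
  rw [(summable_coProjBmAt hN hr hg α).tsum_sub (hg α)] at h
  linarith

/-! ## §3 The total of a `Πᵀ_bm`-dressed slot over ONE CELL, for a periodic one-form -/

/-- [folklore] The window sum of one `Πᵀ_bm` entry IS a lattice sum (the matrix entry vanishes off the window, `window_of_pmBm_ne_zero`). -/
theorem coProjBmAt_eq_tsum (hN : 1 ≤ N) (hr : r ∈ box (d + 1) N) (F : Form1 (d + 1) ℝ) (α : Fin (d + 1)) (q : Site (d + 1)) :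
    coProjBmAt (toSite r) N F α q = ∑ β : Fin (d + 1), ∑' p : Site (d + 1), pmBm (toSite r) N β p α q * F β p := by
  rw [coProjBmAt_apply, Finset.sum_comm]
  refine Finset.sum_congr rfl fun β _ => ?_
  symm
  rw [tsum_eq_sum (s := (cube (d + 1) N).map (addLeftEmbedding q)) fun p hp => ?_]
  · rw [Finset.sum_map]
    rfl
  · have hz : pmBm (toSite r) N β p α q = 0 := by
      by_contra h
      exact hp (Finset.mem_map.2 ⟨p - q, window_of_pmBm_ne_zero hN hr h, by simp [addLeftEmbedding]⟩)
    rw [hz, zero_mul]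

/-- [folklore] The cell-summed matrix weight `w_β(p) := Σ_{r′ ∈ box} pmBm ρ N β p α (toSite r′)` is finitely supported, hence `w·F` is summable. -/
theorem summable_cellWeight_mul (hN : 1 ≤ N) (hr : r ∈ box (d + 1) N) (F : Form1 (d + 1) ℝ) (α β : Fin (d + 1)) :
    Summable fun p : Site (d + 1) => (∑ r' ∈ box (d + 1) N, pmBm (toSite r) N β p α (toSite r')) * F β p := by
  refine summable_of_ne_finset_zero (s := ((box (d + 1) N) ×ˢ (cube (d + 1) N)).image fun rv => toSite rv.1 + rv.2) fun p hp => ?_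
  have hz : ∀ r' ∈ box (d + 1) N, pmBm (toSite r) N β p α (toSite r') = 0 := by
    intro r' hr'
    by_contra h
    refine hp (Finset.mem_image.2 ⟨(r', p - toSite r'), Finset.mem_product.2 ⟨hr', window_of_pmBm_ne_zero hN hr h⟩, ?_⟩)
    simp
  rw [Finset.sum_eq_zero hz, zero_mul]

/-- [folklore] **THE CELL-SUMMED MATRIX WEIGHT, SUMMED OVER ONE COSET, IS THE FULL ROW SUM**: for every `q`,
`Σ'_t Σ_{r′ ∈ box} pmBm ρ N β (N•t + q) α (toSite r′) = [β = α ∧ q_β % N = N−1]·N` (coarse covariance `pmBm_shift` moves the shift onto the second bond,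
the pairs `(r′, t)` unfold the lattice — `BiStencilZeroMode.tsum_eq_sum_box_tsum` — and gan24-p4's `tsum_pmBm_row` reads the row). -/
theorem tsum_cellWeight_coset (hN : 1 ≤ N) (hr : r ∈ box (d + 1) N) (α β : Fin (d + 1)) (q : Site (d + 1)) :
    ∑' t : Site (d + 1), ∑ r' ∈ box (d + 1) N, pmBm (toSite r) N β ((N : ℤ) • t + q) α (toSite r')
      = if β = α ∧ q β % (N : ℤ) = (N : ℤ) - 1 then (N : ℝ) else 0 := by
  haveI : NeZero N := ⟨by omega⟩
  -- move the shift onto the second bond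
  have esh : ∀ (t : Site (d + 1)) (r' : Fin (d + 1) → ℕ),
      pmBm (toSite r) N β ((N : ℤ) • t + q) α (toSite r') = pmBm (toSite r) N β q α ((N : ℤ) • (-t) + toSite r') := by
    intro t r'
    have h := pmBm_shift (toSite r) hN β q α ((N : ℤ) • (-t) + toSite r') t
    rw [show (N : ℤ) • (-t) + toSite r' + (N : ℤ) • t = toSite r' by rw [smul_neg]; abel] at h
    rw [add_comm ((N : ℤ) • t) q]
    exact h
  simp_rw [esh]
  -- the row is summable, so the cell unfolding applies (after `t ↦ −t`)
  have hrow : Summable fun p : Site (d + 1) => pmBm (toSite r) N β q α p := summable_pmBm_row hN hr β q α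
  have hunf := tsum_eq_sum_box_tsum (N := N) hrow
  -- `Σ'_t Σ_{r′} f(N•(−t) + r′) = Σ_{r′} Σ'_t f(N•t + r′)`
  have hfin : ∀ r' ∈ box (d + 1) N, Summable fun t : Site (d + 1) => pmBm (toSite r) N β q α ((N : ℤ) • (-t) + toSite r') := by
    intro r' _
    have h1 : Summable fun t : Site (d + 1) => pmBm (toSite r) N β q α ((N : ℤ) • t + toSite r') :=
      hrow.comp_injective (InterLevelTransport.sublattice_injective N (toSite r'))
    exact (Equiv.neg (Site (d + 1))).summable_iff.2 h1
  rw [Summable.tsum_finsetSum hfin]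
  have eneg : ∀ r' ∈ box (d + 1) N, ∑' t : Site (d + 1), pmBm (toSite r) N β q α ((N : ℤ) • (-t) + toSite r')
      = ∑' t : Site (d + 1), pmBm (toSite r) N β q α ((N : ℤ) • t + toSite r') := by
    intro r' _
    exact (Equiv.neg (Site (d + 1))).tsum_eq (fun t : Site (d + 1) => pmBm (toSite r) N β q α ((N : ℤ) • t + toSite r'))
  rw [Finset.sum_congr rfl eneg, ← hunf, tsum_pmBm_row hN hr β q α]

/-- NOT IN PRINT; OUR BOOKKEEPING.  **THE TOTAL OF A `Πᵀ_bm`-DRESSED SLOT OVER ONE CELL IS `N` TIMES ITS CELL-FACE SUM, for an `N`-PERIODIC one-form**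
(in-block root `ρ = toSite r`, `1 ≤ N`): if `F β (q + N•t) = F β q` then
`Σ_{r′ ∈ box} coProjBmAt ρ N F α (toSite r′) = N · Σ_{r′ ∈ box} (if (toSite r′)_α % N = N−1 then F α (toSite r′) else 0)`.
(The shape of the FIRST source slot of a jointly covariant table inside `BiStencilZeroMode.zmode`: one cell of first-bond positions against a periodic
reduced one-form.)  Proof: window → lattice sum, finite sums out, periodic regrouping `tsum_mul_periodic` against the cell-summed matrix weight, and the
coset identity `tsum_cellWeight_coset`. -/
theorem sum_box_coProjBmAt_eq_face_of_periodic (hN : 1 ≤ N) (hr : r ∈ box (d + 1) N) {F : Form1 (d + 1) ℝ}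
    (hF : ∀ (β : Fin (d + 1)) (q t : Site (d + 1)), F β (q + (N : ℤ) • t) = F β q) (α : Fin (d + 1)) :
    ∑ r' ∈ box (d + 1) N, coProjBmAt (toSite r) N F α (toSite r')
      = (N : ℝ) * ∑ r' ∈ box (d + 1) N, (if toSite r' α % (N : ℤ) = (N : ℤ) - 1 then F α (toSite r') else 0) := by
  haveI : NeZero N := ⟨by omega⟩
  -- per first-bond position: window → lattice sum, each summand finitely supported
  have hfs : ∀ (r' : Fin (d + 1) → ℕ) (β : Fin (d + 1)), Summable fun p : Site (d + 1) => pmBm (toSite r) N β p α (toSite r') * F β p := by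
    intro r' β
    refine summable_of_ne_finset_zero (s := (cube (d + 1) N).map (addLeftEmbedding (toSite r'))) fun p hp => ?_
    have hz : pmBm (toSite r) N β p α (toSite r') = 0 := by
      by_contra h
      exact hp (Finset.mem_map.2 ⟨p - toSite r', window_of_pmBm_ne_zero hN hr h, by simp [addLeftEmbedding]⟩)
    rw [hz, zero_mul]
  have e1 : ∑ r' ∈ box (d + 1) N, coProjBmAt (toSite r) N F α (toSite r')
      = ∑ β : Fin (d + 1), ∑' p : Site (d + 1), (∑ r' ∈ box (d + 1) N, pmBm (toSite r) N β p α (toSite r')) * F β p := by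
    simp_rw [coProjBmAt_eq_tsum hN hr F α]
    rw [Finset.sum_comm]
    refine Finset.sum_congr rfl fun β _ => ?_
    rw [← Summable.tsum_finsetSum fun r' _ => hfs r' β]
    exact tsum_congr fun p => by rw [Finset.sum_mul]
  rw [e1]
  -- periodic regrouping, component by component
  have e2 : ∀ β : Fin (d + 1), ∑' p : Site (d + 1), (∑ r' ∈ box (d + 1) N, pmBm (toSite r) N β p α (toSite r')) * F β p
      = ∑ r'' ∈ box (d + 1) N, F β (toSite r'') * (if β = α ∧ toSite r'' β % (N : ℤ) = (N : ℤ) - 1 then (N : ℝ) else 0) := by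
    intro β
    rw [tsum_mul_periodic (N := N) (fun u t => hF β u t) (summable_cellWeight_mul hN hr F α β)]
    exact Finset.sum_congr rfl fun r'' _ => by rw [tsum_cellWeight_coset hN hr α β (toSite r'')]
  simp_rw [e2]
  rw [Finset.sum_comm, Finset.mul_sum]
  refine Finset.sum_congr rfl fun r'' _ => ?_
  rw [Finset.sum_eq_single α (fun β _ hβ => by rw [if_neg (fun h => hβ h.1), mul_zero]) (fun h => absurd (Finset.mem_univ α) h)]
  by_cases hf : toSite r'' α % (N : ℤ) = (N : ℤ) - 1
  · rw [if_pos ⟨rfl, hf⟩, if_pos hf, mul_comm]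
  · rw [if_neg (fun h => hf h.2), if_neg hf, mul_zero, mul_zero]

/-! ## §4 Instances: an2's bond slot `coProjBmAtK`, one kernel leg, both kernel legs -/

/-- NOT IN PRINT; OUR BOOKKEEPING.  **THE BOND-SLOT DRESSING `coProjBmAtK` READ BY THE SLOT TOTAL** (entrywise §1): for a stencil family whose entry
`u ↦ S β u x y a b` is summable for every `β`, `Σ'_u coProjBmAtK ρ N S κ u x y a b = N·Σ'_u (if u_κ % N = N−1 then S κ u x y a b else 0)`. -/
theorem tsum_coProjBmAtK_eq_face (hN : 1 ≤ N) (hr : r ∈ box (d + 1) N) {S : Fin (d + 1) → Site (d + 1) → MKer (d + 1) (Fib d)}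
    (x y : Site (d + 1)) (a b : Fib d) (hS : ∀ β, Summable fun u : Site (d + 1) => S β u x y a b) (κ : Fin (d + 1)) :
    ∑' u : Site (d + 1), coProjBmAtK (toSite r) N S κ u x y a b
      = (N : ℝ) * ∑' u : Site (d + 1), (if u κ % (N : ℤ) = (N : ℤ) - 1 then S κ u x y a b else 0) := by
  simp_rw [coProjBmAtK_eval]
  exact tsum_coProjBmAt_eq_face hN hr (g := fun β u => S β u x y a b) hS κ

/-- NOT IN PRINT; OUR BOOKKEEPING.  **THE FIRST KERNEL LEG**: `Σ'_x legCo₁BmAt ρ N K x y (inl α) b = N·Σ'_x (if x_α % N = N−1 then K x y (inl α) b else 0)`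
(field row; the `x ↦ K x y (inl α′) b` summable for every `α′`). -/
theorem tsum_legCo₁BmAt_inl_eq_face (hN : 1 ≤ N) (hr : r ∈ box (d + 1) N) {K : MKer (d + 1) (Fib d)} (y : Site (d + 1)) (b : Fib d)
    (hK : ∀ α', Summable fun x : Site (d + 1) => K x y (Sum.inl α') b) (α : Fin (d + 1)) :
    ∑' x : Site (d + 1), legCo₁BmAt (toSite r) N K x y (Sum.inl α) b
      = (N : ℝ) * ∑' x : Site (d + 1), (if x α % (N : ℤ) = (N : ℤ) - 1 then K x y (Sum.inl α) b else 0) := by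
  simp_rw [legCo₁BmAt_inl]
  exact tsum_coProjBmAt_eq_face hN hr (g := fun α' x' => K x' y (Sum.inl α') b) hK α

/-- NOT IN PRINT; OUR BOOKKEEPING.  **THE SECOND KERNEL LEG**: `Σ'_z legCo₂BmAt ρ N K x z a (inl β) = N·Σ'_z (if z_β % N = N−1 then K x z a (inl β) else 0)`. -/
theorem tsum_legCo₂BmAt_inl_eq_face (hN : 1 ≤ N) (hr : r ∈ box (d + 1) N) {K : MKer (d + 1) (Fib d)} (x : Site (d + 1)) (a : Fib d)
    (hK : ∀ β', Summable fun z : Site (d + 1) => K x z a (Sum.inl β')) (β : Fin (d + 1)) :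
    ∑' z : Site (d + 1), legCo₂BmAt (toSite r) N K x z a (Sum.inl β)
      = (N : ℝ) * ∑' z : Site (d + 1), (if z β % (N : ℤ) = (N : ℤ) - 1 then K x z a (Sum.inl β) else 0) := by
  simp_rw [legCo₂BmAt_inl]
  exact tsum_coProjBmAt_eq_face hN hr (g := fun β' z' => K x z' a (Sum.inl β')) hK β

/-- NOT IN PRINT; OUR BOOKKEEPING.  **BOTH KERNEL LEGS, ITERATED SUMS** (in-block root, `1 ≤ N`; table with summable field–field PAIR sums — the hypothesis of
gan24-p4's `PiBmConstants.tsum_prod_dressKBmAt_inl_inl`, whose pair-`tsum` identity this re-reads for the iterated sums of `BiStencilZeroMode.zmode`):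
`Σ'_x Σ'_z dressKBmAt ρ N X x z (inl α) (inl β) = N²·Σ'_x Σ'_z (if x_α % N = N−1 ∧ z_β % N = N−1 then X x z (inl α) (inl β) else 0)`. -/
theorem tsum_tsum_dressKBmAt_inl_inl_eq_face (hN : 1 ≤ N) (hr : r ∈ box (d + 1) N) {X : MKer (d + 1) (Fib d)}
    (hX : ∀ α' β' : Fin (d + 1), Summable fun xz : Site (d + 1) × Site (d + 1) => X xz.1 xz.2 (Sum.inl α') (Sum.inl β'))
    (α β : Fin (d + 1)) :
    ∑' x : Site (d + 1), ∑' z : Site (d + 1), dressKBmAt (toSite r) N X x z (Sum.inl α) (Sum.inl β)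
      = (N : ℝ) ^ 2 * ∑' x : Site (d + 1), ∑' z : Site (d + 1),
          (if x α % (N : ℤ) = (N : ℤ) - 1 ∧ z β % (N : ℤ) = (N : ℤ) - 1 then X x z (Sum.inl α) (Sum.inl β) else 0) := by
  have hD := PiBmConstants.summable_prod_dressKBmAt_inl_inl hN hr hX α β
  have hF : Summable fun xz : Site (d + 1) × Site (d + 1) =>
      (if xz.1 α % (N : ℤ) = (N : ℤ) - 1 ∧ xz.2 β % (N : ℤ) = (N : ℤ) - 1 then X xz.1 xz.2 (Sum.inl α) (Sum.inl β) else 0) := by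
    refine Summable.of_norm_bounded (hX α β).abs fun xz => ?_
    rw [Real.norm_eq_abs]
    split_ifs
    · exact le_rfl
    · rw [abs_zero]; exact abs_nonneg _
  rw [← hD.tsum_prod, PiBmConstants.tsum_prod_dressKBmAt_inl_inl hN hr hX α β, hF.tsum_prod]

end Summit.QuantumFields.BalabanUV.Beta.GAN24.CoProjSlotCharges

end
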